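import Summits.Parity.GeneralizedHardyLittlewood.Theorems.GoldbachHeathBrownDispersionHeathBrownMorozUniformSigmaOneCoprime
import Summits.Parity.GeneralizedHardyLittlewood.Theorems.GoldbachHeathBrownDispersionHeathBrownMorozUniformClassTypeISqfree
import Summits.Parity.GeneralizedHardyLittlewood.Theorems.GoldbachHeathBrownDispersionHeathBrownMorozUniformClassDisplay104
import Summits.Parity.GeneralizedHardyLittlewood.Theorems.GoldbachHeathBrownDispersionHeathBrownMorozUniformOfClassLemmas
import Literature.NumberTheory.Sieve.HeathBrownCubicLeadingA
import Literature.NumberTheory.Sieve.HeathBrownCubicPrimesProofs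
import Literature.NumberTheory.Sieve.HeathBrownMorozResidueClassesSieve
import Literature.NumberTheory.Sieve.HeathBrownMorozClassTypeI
import Literature.NumberTheory.Sieve.HeathBrownMorozClassPairCount
import HarnessLib

/-!
# Crux `HeathBrownMorozUniform` (stmt-Parity-19915): the class leading parts `h39` PROVED

Heath-Brown, Acta Math. 186 (2001), Lemma 3.9 / §10 (10.1)–(10.4), for the class family `classPairs X η d a b` of
Heath-Brown–Moroz 2004, Lemma 4.1: the proved glue of the merged skeleton
`Cruxes/HeathBrownMorozUniform/Lines/unit_split_positivity.lean` (Part A: `class_typeI_dyadic`,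
`classTypeISqfreeSum_holds` = S4a, the triangle-inequality glue, `classLeadingDifferencing_of_display104`,
`h39_of_leadingDifferencing`) instantiated at the two LANDED linear-sieve stubs — S3 `classSigmaOneCoprime`
(p560964) and S4b `classDisplay104_of_typeISqfreeSum_of_sigmaOneCoprime` (p562472) — copied letter for letter with
the statement-defs unfolded. Result: `class_h39`, literally the hypothesis `h39` of
`heathBrownMorozUniform_of_classLemmas` / `…_of_twoClassLemmas`. Goldbach is not proved by this.

## References

* D. R. Heath-Brown, Acta Math. 186 (2001), Lemma 3.9, §10 (10.1)–(10.4). [cite: HeathBrownActa2001, Lemma 3.9]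
* D. R. Heath-Brown, B. Z. Moroz, Proc. London Math. Soc. 88 (2004), Lemma 4.1. [cite: HeathBrownMoroz2004, Lemma 4.1]
-/

noncomputable section

open Polynomial NumberField Finset Filter Topology Asymptotics

namespace Summit.Parity.GeneralizedHardyLittlewood.Theorems.GoldbachHeathBrownDispersionHeathBrownMorozUniform

open Literature.NumberTheory.Sieve.CubicSieve Literature.NumberTheory.Sieve.CubicPrimes
open Literature.NumberTheory.LFunctions.CubeRootTwoField

/-- The triangle inequality through the scaled parent: `|A − wκB| ≤ |A − wP| + w|P − κB|` for `w ≥ 0`.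
[cite: HeathBrownMoroz2004, Lemma 4.1] -/
theorem abs_sub_le_of_mid {A P B w κ : ℝ} (hw : 0 ≤ w) :
    |A - w * κ * B| ≤ |A - w * P| + w * |P - κ * B| := by
  have h := abs_sub_le A (w * P) (w * κ * B)
  have e : w * P - w * κ * B = w * (P - κ * B) := by ring
  rw [e, abs_mul, abs_of_nonneg hw] at h
  exact h

/-- `|A − wB| ≤ |A − wP| + w|P − B|` for `w ≥ 0` (class (10.4) vs the scaled parent (10.4)). [cite: HeathBrownMoroz2004, Lemma 4.1] -/
theorem abs_sub_le_of_mid₁ {A P B w : ℝ} (hw : 0 ≤ w) :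
    |A - w * B| ≤ |A - w * P| + w * |P - B| := by
  have h := abs_sub_le A (w * P) (w * B)
  have e : w * P - w * B = w * (P - B) := by ring
  rw [e, abs_mul, abs_of_nonneg hw] at h
  exact h

/-- `|A − wP| ≤ |A − wκB| + w|P − κB|` for `w ≥ 0` (EQ35 from the direct class Lemma 3.5 and the parent's).
[cite: HeathBrownMoroz2004, Lemma 4.1] -/
theorem abs_sub_le_of_mid₂ {A P B w κ : ℝ} (hw : 0 ≤ w) :
    |A - w * P| ≤ |A - w * κ * B| + w * |P - κ * B| := by
  have h := abs_sub_le A (w * κ * B) (w * P)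
  have e : w * κ * B - w * P = w * (κ * B - P) := by ring
  rw [e, abs_mul, abs_of_nonneg hw, abs_sub_comm (κ * B) P] at h
  exact h

/-- Merging two power-of-log bounds: `C·F·L^c ≤ |C|·F·L^{c'}` for `F ≥ 0`, `L ≥ 1`, `c ≤ c'`
(`F = M⁻¹η^{5/2}X²` written as three factors). [cite: HeathBrownMoroz2004, Lemma 4.1] -/
theorem const_rpow_mono {C M E X2 L c c' : ℝ} (hM : 0 ≤ M) (hE : 0 ≤ E) (hX : 0 ≤ X2) (hL : 1 ≤ L)
    (hc : c ≤ c') : C * M * E * X2 * L ^ c ≤ |C| * M * E * X2 * L ^ c' := by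
  have h1 : 0 ≤ L ^ c := Real.rpow_nonneg (by linarith) _
  have h2 : L ^ c ≤ L ^ c' := Real.rpow_le_rpow_of_exponent_le hL hc
  have hF : 0 ≤ M * E * X2 := mul_nonneg (mul_nonneg hM hE) hX
  have e1 : C * M * E * X2 * L ^ c = C * (M * E * X2) * L ^ c := by ring
  have e2 : |C| * M * E * X2 * L ^ c' = |C| * (M * E * X2) * L ^ c' := by ring
  rw [e1, e2]
  calc C * (M * E * X2) * L ^ c ≤ |C| * (M * E * X2) * L ^ c :=
        mul_le_mul_of_nonneg_right (mul_le_mul_of_nonneg_right (le_abs_self C) hF) h1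
    _ ≤ |C| * (M * E * X2) * L ^ c' := mul_le_mul_of_nonneg_left h2 (mul_nonneg (abs_nonneg C) hF)

/-- `w(d)/d² ≥ 0`. [cite: HeathBrownMoroz2004, (3.1)] -/
theorem classWeight_div_sq_nonneg (d : ℕ) : 0 ≤ classWeight d / (d : ℝ) ^ 2 :=
  div_nonneg (classWeight_pos d).le (pow_nonneg (Nat.cast_nonneg d) 2)

/-- **The class display (10.4) holds** (S4b instantiated at S4a and S3): the landed
`classDisplay104_of_typeISqfreeSum_of_sigmaOneCoprime` (p562472, stub-worker `ghb-stub-display104-p1`) applied to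
`classTypeISqfreeSum_holds` and the landed `classSigmaOneCoprime` (p560964, stub-worker `ghb-stub-sigma1-p1`).
[cite: HeathBrownActa2001, §10 (10.4)] [cite: HeathBrownMoroz2004, Lemma 4.1] -/
theorem classDisplay104_holds :
  ∀ d a b : ℕ, 0 < d → a < d → b < d → Nat.Coprime (a ^ 3 + 2 * b ^ 3) d →
    ∀ σ₀ : ℝ, Tendsto singularProductPartial atTop (𝓝 σ₀) → ∀ ϖ : ℝ, 0 < ϖ → ϖ < 1 / 5 →
      ∃ c C X₀ : ℝ, ∀ X η : ℝ, X₀ ≤ X → Real.exp (-Real.log X ^ (1 / 3 : ℝ)) ≤ η → η ≤ 1 →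
        ∀ (k : ℕ) (m : Fin k → ℕ), CoreAdmissible (hbTau ϖ X) m →
          ∀ cR : Ideal (𝓞 K) → ℝ, CSupport X (hbTau ϖ X) cR →
            |bilin (classPairs X η d a b) pairIdeal cR (eWeight X (hbTau ϖ X) m) -
                classWeight d / (d : ℝ) ^ 2 * (σ₀ * η ^ 2 * X ^ 2 * sigma3 X (hbTau ϖ X) m cR)| ≤
              C * (∏ i, (m i : ℝ))⁻¹ * η ^ (5 / 2 : ℝ) * X ^ 2 * Real.log X ^ c :=
  classDisplay104_of_typeISqfreeSum_of_sigmaOneCoprime classTypeISqfreeSum_holds classSigmaOneCoprime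


/-- **EQ39 from the class display (10.4) (S4b) and the parent's display (10.4)** (tree:
`HeathBrown2001_display_10_4`): `Û_e(𝒜_cl) − (w/d²)Û_e(𝒜) = [Û_e(𝒜_cl) − (w/d²)σ₀η²X²Σ₃] − (w/d²)[Û_e(𝒜) − σ₀η²X²Σ₃]`,
`σ₀` from `HeathBrown2001_singularProduct_holds`; exponents merged to `max c₁ c₂` (`log X ≥ 1` for `X ≥ e`),
constants `|C₁| + (w/d²)|C₂|`. [cite: HeathBrownActa2001, §10 (10.4)] [cite: HeathBrownMoroz2004, Lemma 4.1] -/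
theorem classLeadingDifferencing_holds :
  ∀ d a b : ℕ, 0 < d → a < d → b < d → Nat.Coprime (a ^ 3 + 2 * b ^ 3) d →
    ∀ ϖ : ℝ, 0 < ϖ → ϖ < 1 / 5 →
      ∃ c C X₀ : ℝ, ∀ X η : ℝ, X₀ ≤ X → Real.exp (-Real.log X ^ (1 / 3 : ℝ)) ≤ η → η ≤ 1 →
        ∀ (k : ℕ) (m : Fin k → ℕ), CoreAdmissible (hbTau ϖ X) m →
          ∀ cR : Ideal (𝓞 K) → ℝ, CSupport X (hbTau ϖ X) cR →
            |bilin (classPairs X η d a b) pairIdeal cR (eWeight X (hbTau ϖ X) m) -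
                classWeight d / (d : ℝ) ^ 2 *
                  bilin (boxPairs X η) pairIdeal cR (eWeight X (hbTau ϖ X) m)| ≤
              C * (∏ i, (m i : ℝ))⁻¹ * η ^ (5 / 2 : ℝ) * X ^ 2 * Real.log X ^ c := by
  intro d a b hd ha hb hadm ϖ hϖ0 hϖ5
  obtain ⟨σ₀, -, hσ⟩ := HeathBrown2001_singularProduct_holds
  obtain ⟨c₁, C₁, X₁, h₁⟩ := classDisplay104_holds d a b hd ha hb hadm σ₀ hσ ϖ hϖ0 hϖ5
  obtain ⟨c₂, C₂, X₂, h₂⟩ := HeathBrown2001_display_10_4 σ₀ hσ ϖ hϖ0 hϖ5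
  have hw := classWeight_div_sq_nonneg d
  refine ⟨max c₁ c₂, |C₁| + classWeight d / (d : ℝ) ^ 2 * |C₂|, max (max X₁ X₂) (Real.exp 1), ?_⟩
  intro X η hX hη hη1 k m hm cR hcR
  have hX1 : X₁ ≤ X := (le_max_left _ _).trans ((le_max_left _ _).trans hX)
  have hX2 : X₂ ≤ X := (le_max_right _ _).trans ((le_max_left _ _).trans hX)
  have hXe : Real.exp 1 ≤ X := (le_max_right _ _).trans hX
  have hlog : 1 ≤ Real.log X := by
    have h := Real.log_le_log (Real.exp_pos 1) hXe
    rwa [Real.log_exp] at h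
  have hη0 : 0 ≤ η := (Real.exp_pos _).le.trans hη
  have hM : 0 ≤ (∏ i, (m i : ℝ))⁻¹ := inv_nonneg.2 (prod_nonneg fun i _ => Nat.cast_nonneg _)
  have hE : 0 ≤ η ^ (5 / 2 : ℝ) := Real.rpow_nonneg hη0 _
  have hX2' : 0 ≤ X ^ 2 := sq_nonneg X
  have e₁ := h₁ X η hX1 hη hη1 k m hm cR hcR
  have e₂ := h₂ X η hX2 hη hη1 k m hm cR hcR
  rw [abs_sub_comm] at e₂
  refine (abs_sub_le_of_mid₁
    (P := σ₀ * η ^ 2 * X ^ 2 * sigma3 X (hbTau ϖ X) m cR) hw).trans ?_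
  refine (add_le_add (e₁.trans (const_rpow_mono hM hE hX2' hlog (le_max_left c₁ c₂)))
    (mul_le_mul_of_nonneg_left (e₂.trans (const_rpow_mono hM hE hX2' hlog (le_max_right c₁ c₂)))
      hw)).trans_eq ?_
  ring

/-- **`h39` from EQ39 and the parent's Lemma 3.9 (tree: `HeathBrown2001_lemma_3_9_holds`).**
`Û_e(𝒜_cl) − κ_d Û(ℬ) = [Û_e(𝒜_cl) − (w/d²)Û_e(𝒜)] + (w/d²)[Û_e(𝒜) − κÛ(ℬ)]`; exponents merged to
`max c₁ c₂` using `log X ≥ 1` (`X₀ ≥ e`), constants `|C₁| + (w/d²)|C₂|`. [cite: HeathBrownMoroz2004, Lemma 4.1]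
[cite: HeathBrownActa2001, Lemma 3.9] -/
theorem class_h39 :
    ∀ d a b : ℕ, 0 < d → a < d → b < d → Nat.Coprime (a ^ 3 + 2 * b ^ 3) d →
      ∀ σ₀ : ℝ, Tendsto singularProductPartial atTop (𝓝 σ₀) → ∀ ϖ : ℝ, 0 < ϖ → ϖ < 1 / 5 →
        ∃ c C X₀ : ℝ, ∀ X η : ℝ, X₀ ≤ X → Real.exp (-Real.log X ^ (1 / 3 : ℝ)) ≤ η → η ≤ 1 →
          ∀ (k : ℕ) (m : Fin k → ℕ), CoreAdmissible (hbTau ϖ X) m →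
            ∀ cR : Ideal (𝓞 K) → ℝ, CSupport X (hbTau ϖ X) cR →
              |bilin (classPairs X η d a b) pairIdeal cR (eWeight X (hbTau ϖ X) m) -
                  classKappa σ₀ X η d *
                    bilin (normWindow X η) (fun J => J) cR (dWeight X (hbTau ϖ X) m)| ≤
                C * (∏ i, (m i : ℝ))⁻¹ * η ^ (5 / 2 : ℝ) * X ^ 2 * Real.log X ^ c := by
  intro d a b hd ha hb hadm σ₀ hσ ϖ hϖ0 hϖ5
  obtain ⟨c₁, C₁, X₁, h₁⟩ := classLeadingDifferencing_holds d a b hd ha hb hadm ϖ hϖ0 hϖ5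
  obtain ⟨c₂, C₂, X₂, h₂⟩ := HeathBrown2001_lemma_3_9_holds σ₀ hσ ϖ hϖ0 hϖ5
  have hw := classWeight_div_sq_nonneg d
  refine ⟨max c₁ c₂, |C₁| + classWeight d / (d : ℝ) ^ 2 * |C₂|, max (max X₁ X₂) (Real.exp 1), ?_⟩
  intro X η hX hη hη1 k m hm cR hcR
  have hX1 : X₁ ≤ X := (le_max_left _ _).trans ((le_max_left _ _).trans hX)
  have hX2 : X₂ ≤ X := (le_max_right _ _).trans ((le_max_left _ _).trans hX)
  have hXe : Real.exp 1 ≤ X := (le_max_right _ _).trans hX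
  have hlog : 1 ≤ Real.log X := by
    have h := Real.log_le_log (Real.exp_pos 1) hXe
    rwa [Real.log_exp] at h
  have hη0 : 0 ≤ η := (Real.exp_pos _).le.trans hη
  have hM : 0 ≤ (∏ i, (m i : ℝ))⁻¹ := inv_nonneg.2 (prod_nonneg fun i _ => Nat.cast_nonneg _)
  have hE : 0 ≤ η ^ (5 / 2 : ℝ) := Real.rpow_nonneg hη0 _
  have hX2' : 0 ≤ X ^ 2 := sq_nonneg X
  have e₁ := h₁ X η hX1 hη hη1 k m hm cR hcR
  have e₂ := h₂ X η hX2 hη hη1 k m hm cR hcR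
  simp only [classKappa_def]
  refine (abs_sub_le_of_mid
    (P := bilin (boxPairs X η) pairIdeal cR (eWeight X (hbTau ϖ X) m)) hw).trans ?_
  refine (add_le_add (e₁.trans (const_rpow_mono hM hE hX2' hlog (le_max_left c₁ c₂)))
    (mul_le_mul_of_nonneg_left (e₂.trans (const_rpow_mono hM hE hX2' hlog (le_max_right c₁ c₂)))
      hw)).trans_eq ?_
  ring

end Summit.Parity.GeneralizedHardyLittlewood.Theorems.GoldbachHeathBrownDispersionHeathBrownMorozUniform

end
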